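import Literature.Topology.FourManifolds.CappellShanesonSimplyConnected
import Literature.Topology.FourManifolds.CappellShanesonCover
import Literature.AlgebraicTopology.FundamentalGroupoid.SimplyConnectedComplDiscrete
import Literature.Topology.FourManifolds.KnotFraming
import Mathlib.Topology.Instances.ZMultiples
import Mathlib.Topology.Order.ProjIcc
import HarnessLib

/-!
# Cappell–Shaneson spheres are simply connected: proofs

Sibling proof file (D-0014) of `Literature.Topology.FourManifolds.CappellShaneson`: it discharges
the named fact

* `Literature.SPC4.simplyConnectedSpace_of_isCappellShanesonSphere_holds :
  SPC4.simplyConnectedSpace_of_isCappellShanesonSphere X` — **every Cappell–Shaneson sphere is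
  simply connected** (Cappell–Shaneson, *Some new four-manifolds*, Ann. of Math. 104 (1976), §2,
  where it is asserted, without proof, that surgery on the section circle of the mapping torus
  `T_A` of `A ∈ SL(3, ℤ)` with `det (A - 1) = ±1` yields a homotopy 4-sphere; also Gompf,
  Algebr. Geom. Topol. 10 (2010), §2: "`X^ε_φ` is a homotopy 4-sphere iff `det (A - I) = ±1`"),

by way of the intermediate named fact of the decomposition,

* `Literature.CappellShaneson.normalClosure_pushOff_eq_top_holds : normalClosure_pushOff_eq_top`
  (`CappellShanesonSimplyConnected.lean`): `π₁(T ∖ c(𝕊¹))` is the normal closure of the push-off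
  of the section circle `c`,

and the reduction `Literature.Topology.FourManifolds.CappellShaneson.simplyConnectedSpace_of_isCappellShanesonSphere_of`
(van Kampen's easy half) proved there.

## The argument (no printed source spells it out; Cappell–Shaneson and Gompf call it easy)

1. `exists_homeomorph_mappingTorus_of_isOpenEmbedding`: the glued manifold `T` of
   `IsCappellShanesonSphereOf` is homeomorphic to the model mapping torus
   `T_A = T³ × ℝ / (z, t) ∼ (A z, t + 1)` by a homeomorphism `Φ` which is the quotient map on each
   cylinder (the recognition theorem of `MappingTorusProofs.lean`, with the formula retained); `Φ`
   carries the section circle `range c` onto `modelSection A = {[(1, t)]}`.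
2. `CappellShanesonCover.lean`: `(ℝ³ ∖ 2πℤ³) × ℝ → T_A ∖ section` is a quotient covering map for
   the free action of `Γ = ℤ³ ⋊_A ℤ`; its total space is simply connected
   (`simplyConnectedSpace_coverSub` below: `ℝ³ ∖ 2πℤ³` is simply connected by general position,
   `Literature.AlgebraicTopology.FundamentalGroupoid.isSimplyConnected_compl_of_finite_inter_closedBall`, times `ℝ`); transported along `Φ`
   it covers `T ∖ c(𝕊¹) = ν.complement`, and Mathlib's
   `IsQuotientCoveringMap.fundamentalGroupToMulOpposite` (Hatcher, Prop. 1.40) is a group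
   isomorphism `ρ : π₁(T ∖ c, ν((1,0), w)) ≅ Γᵒᵖ`, `ρ[δ] = op g` where `g` moves the base point
   of the cover to the end of the lift of `δ`.
3. `snd_sub_snd_of_lift_pushOff` (**the degree of the push-off is `±1`**): lift the homotopy
   `(t, s) ↦ ν(circlePt t, (1 - s) w)` from the push-off to the core circle through the covering
   `ℝ³ × ℝ → T`; the `ℝ`-displacement of the lifted loops is an integer depending continuously on
   `s`, hence constant; the lift of the core `t ↦ c (circlePt t)` lies in `2πℤ³ × ℝ`, so it is
   `(x₁, τ t)` with `c (circlePt t) = Φ⁻¹[(1, τ t)]`, and injectivity of `c` plus the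
   intermediate value theorem give `τ 1 - τ 0 = ±1`. Hence `g = ⟨n, ±1⟩`.
4. `Deck.normalClosure_eq_top` (`CappellShanesonCover.lean`, uses `det (A - 1) = ±1`): `g⁻¹`
   normally generates `Γ`, so `op g = ρ[push-off]` normally generates `Γᵒᵖ`, and pulling back
   along the isomorphism `ρ` (`Subgroup.map_normalClosure`) gives the fact.

## References

* S. E. Cappell, J. L. Shaneson, *Some new four-manifolds*, Ann. of Math. 104 (1976) 61–72, §2
  [CappellShanesonAnnals1976].
* R. E. Gompf, *More Cappell–Shaneson spheres are standard*, Algebr. Geom. Topol. 10 (2010)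
  1665–1681, §2 [GompfAGT2010]; R. E. Gompf, Topology Appl. 38 (1991) 123–136, p. 124.
* A. Hatcher, *Algebraic Topology* (2002), §1.1 (degree of circle maps), §1.3, Prop. 1.30
  (homotopy lifting), Prop. 1.40 [HatcherAT2002].

No declaration in this file uses `sorry`; `#print axioms` of the two discharges is
`propext, Classical.choice, Quot.sound`.
-/

noncomputable section

open Set Function Metric Topology unitInterval
open scoped Manifold Real Matrix ContDiff

namespace Literature.Topology.FourManifolds

namespace CappellShaneson

/-! ### The universal cover of the section complement is simply connected -/

section SimplyConnectedCover

variable (A : Matrix.SpecialLinearGroup (Fin 3) ℤ)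

/-- The lattice `2πℤ³ = expT ⁻¹ {1}` meets every ball in a finite set. [folklore] -/
theorem finite_lattice_inter_closedBall (R : ℝ) :
    ({x : EuclideanSpace ℝ (Fin 3) | expT x = 1} ∩ closedBall 0 R).Finite := by
  set N : ℤ := ⌈R / (2 * π)⌉ with hN
  have hfin : {n : Fin 3 → ℤ | ∀ j, n j ∈ Icc (-N) N}.Finite :=
    Set.Finite.pi' fun _ ↦ Set.finite_Icc _ _
  refine (hfin.image latVec).subset ?_
  rintro x ⟨hx, hxR⟩
  rw [mem_setOf_eq, expT_eq_one_iff] at hx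
  obtain ⟨n, rfl⟩ := hx
  refine ⟨n, fun j ↦ ?_, rfl⟩
  rw [mem_closedBall_zero_iff] at hxR
  have hj : |2 * π * (n j : ℝ)| ≤ R := by
    have h := PiLp.norm_apply_le (latVec n) j
    rw [latVec_apply, Real.norm_eq_abs] at h
    exact h.trans hxR
  rw [abs_mul, abs_of_pos Real.two_pi_pos] at hj
  have hj' : |(n j : ℝ)| ≤ R / (2 * π) := by
    rw [le_div_iff₀ Real.two_pi_pos, mul_comm]
    exact hj
  have hj'' : |(n j : ℝ)| ≤ N := hj'.trans (Int.le_ceil _)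
  rw [mem_Icc, ← abs_le]
  exact_mod_cast hj''

/-- **`ℝ³ ∖ 2πℤ³` is simply connected** (general position, dimension `3`;
`isSimplyConnected_compl_of_finite_inter_closedBall`). [folklore] -/
theorem isSimplyConnected_compl_lattice :
    IsSimplyConnected {x : EuclideanSpace ℝ (Fin 3) | expT x = 1}ᶜ :=
  Literature.AlgebraicTopology.FundamentalGroupoid.isSimplyConnected_compl_of_finite_inter_closedBall
    (by rw [finrank_euclideanSpace_fin]; norm_num) finite_lattice_inter_closedBall

/-- **The universal cover `E = (ℝ³ ∖ 2πℤ³) × ℝ` of the section complement is simply connected**: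
`E ≃ₜ (ℝ³ ∖ 2πℤ³) × ℝ`, `ℝ³ ∖ 2πℤ³` is simply connected by general position
(`isSimplyConnected_compl_lattice`), `ℝ` is contractible, and a product of simply connected
spaces is simply connected (`Literature.Topology.FourManifolds.simplyConnectedSpace_prod`; Hatcher, *Algebraic Topology*,
proof of Prop. 1.14 and Prop. 1.12). A theorem rather than an instance (proof files carry no
definitions); users write `haveI := simplyConnectedSpace_coverSub A`. [folklore] -/
theorem simplyConnectedSpace_coverSub : SimplyConnectedSpace ↥(coverSub A) := by
  -- the obvious homeomorphism `E ≃ₜ (ℝ³ ∖ 2πℤ³) × ℝ`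
  let L : Set (EuclideanSpace ℝ (Fin 3)) := {x | expT x = 1}
  let e : ↥(coverSub A) ≃ₜ ↥Lᶜ × ℝ :=
    { toFun := fun y ↦ (⟨(y : EuclideanSpace ℝ (Fin 3) × ℝ).1, (mem_coverSub_iff A _).1 y.2⟩,
        (y : EuclideanSpace ℝ (Fin 3) × ℝ).2)
      invFun := fun q ↦ ⟨((q.1 : EuclideanSpace ℝ (Fin 3)), q.2), (mem_coverSub_iff A _).2 q.1.2⟩
      left_inv := fun _ ↦ rfl
      right_inv := fun _ ↦ rfl
      continuous_toFun := by fun_prop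
      continuous_invFun := by fun_prop }
  haveI h1 : SimplyConnectedSpace ↥Lᶜ := isSimplyConnected_compl_lattice
  haveI : SimplyConnectedSpace (↥Lᶜ × ℝ) := Literature.Topology.FourManifolds.simplyConnectedSpace_prod
  exact e.toHomotopyEquiv.simplyConnectedSpace

end SimplyConnectedCover

/-! ### The comparison homeomorphism with the model mapping torus, with its formula -/

section Comparison

variable {M : Type*} [TopologicalSpace M] {T : Type*} [TopologicalSpace T]

/-- **Recognition of the mapping torus, with the formula.** If `T` is covered by open topological
embeddings `jA : M × (0, 1) → T`, `jB : M × (1/2, 3/2) → T` identifying exactly the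
`mappingTorusRel φ`-related points, then there is a homeomorphism `Φ : T ≃ₜ T_φ` onto the model
mapping torus `M × ℝ / (x, t) ∼ (φ x, t + 1)` *which is the quotient map on each cylinder*:
`Φ (jA (x, s)) = [(x, s)]`, `Φ (jB (x, t)) = [(x, t)]`. This is
`Literature.Topology.FourManifolds.nonempty_homeomorph_mappingTorus_of_isOpenEmbedding` (`MappingTorusProofs.lean`) with the
defining property of the comparison map retained (same proof) (Hatcher, *Algebraic Topology*
(2002), Ch. 2 Example 2.48). [cite: HatcherAT2002, Ex. 2.48] -/
theorem exists_homeomorph_mappingTorus_of_isOpenEmbedding (φ : M ≃ₜ M)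
    {jA : M × mappingTorusPieceOne → T} {jB : M × mappingTorusPieceTwo → T}
    (hA : IsOpenEmbedding jA) (hB : IsOpenEmbedding jB) (hU : range jA ∪ range jB = univ)
    (hR : ∀ a b, jA a = jB b ↔ mappingTorusRel φ a b) :
    ∃ Φ : T ≃ₜ MappingTorus φ, (∀ a, Φ (jA a) = MappingTorus.mk φ a.1 a.2) ∧
      ∀ b, Φ (jB b) = MappingTorus.mk φ b.1 b.2 := by
  classical
  -- the quotient map on the two cylinders
  set qA : M × mappingTorusPieceOne → MappingTorus φ := fun a => MappingTorus.mk φ a.1 a.2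
    with hqA_def
  set qB : M × mappingTorusPieceTwo → MappingTorus φ := fun b => MappingTorus.mk φ b.1 b.2
    with hqB_def
  have hqAB : ∀ a b, qA a = qB b ↔ jA a = jB b := fun a b => by
    rw [hR, hqA_def, hqB_def, MappingTorus.mk_eq_mk_iff_mappingTorusRel]
  have hcover : ∀ p, p ∈ range jA ∨ p ∈ range jB := fun p => by
    simpa only [← mem_union, hU] using mem_univ p
  -- the comparison map
  set f : T → MappingTorus φ := fun p =>
    if h : p ∈ range jA then qA (Classical.choose h)
    else qB (Classical.choose ((hcover p).resolve_left h)) with hf_def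
  have hfA : ∀ a, f (jA a) = qA a := fun a => by
    have h : jA a ∈ range jA := mem_range_self a
    rw [hf_def]
    dsimp only
    rw [dif_pos h]
    congr 1
    exact hA.injective (Classical.choose_spec h)
  have hfB : ∀ b, f (jB b) = qB b := fun b => by
    by_cases h : jB b ∈ range jA
    · obtain ⟨a, ha⟩ := h
      rw [← ha, hfA, hqAB, ha]
    · rw [hf_def]
      dsimp only
      rw [dif_neg h]
      congr 1
      exact hB.injective (Classical.choose_spec ((hcover (jB b)).resolve_left h))
  have hfA' : f ∘ jA = qA := funext hfA
  have hfB' : f ∘ jB = qB := funext hfB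
  -- continuity
  have hcont : Continuous f := by
    refine continuous_iff_continuousAt.2 fun p => ?_
    obtain ⟨a, rfl⟩ | ⟨b, rfl⟩ := hcover p
    · exact hA.continuousAt_iff.1
        (hfA' ▸ (MappingTorus.continuous_mk_pieceOne φ).continuousAt)
    · exact hB.continuousAt_iff.1
        (hfB' ▸ (MappingTorus.continuous_mk_pieceTwo φ).continuousAt)
  -- openness
  have hopen : IsOpenMap f := by
    refine IsOpenMap.of_nhds_le fun p => ?_
    obtain ⟨a, rfl⟩ | ⟨b, rfl⟩ := hcover p
    · rw [← hA.map_nhds_eq, Filter.map_map, hfA', hfA]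
      exact (MappingTorus.isOpenMap_mk_pieceOne φ).nhds_le a
    · rw [← hB.map_nhds_eq, Filter.map_map, hfB', hfB]
      exact (MappingTorus.isOpenMap_mk_pieceTwo φ).nhds_le b
  -- injectivity
  have hinj : Injective f := by
    intro p p' hpp'
    obtain ⟨a, rfl⟩ | ⟨b, rfl⟩ := hcover p <;> obtain ⟨a', rfl⟩ | ⟨b', rfl⟩ := hcover p'
    · rw [hfA, hfA] at hpp'
      rw [MappingTorus.injective_mk_pieceOne φ hpp']
    · rw [hfA, hfB] at hpp'
      exact (hqAB a b').1 hpp'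
    · rw [hfB, hfA] at hpp'
      exact ((hqAB a' b).1 hpp'.symm).symm
    · rw [hfB, hfB] at hpp'
      rw [MappingTorus.injective_mk_pieceTwo φ hpp']
  -- surjectivity
  have hsurj : Surjective f := by
    intro z
    obtain ⟨x, t, ⟨ht0, ht1⟩, rfl⟩ := MappingTorus.exists_mk_eq_of_mem_Ico φ z
    rcases ht0.eq_or_lt with rfl | ht0
    · -- level `0`: `[(x, 0)] = [(φ x, 1)]` and `1 ∈ (1/2, 3/2)`
      have h1 : (1 : ℝ) ∈ mappingTorusPieceTwo := by
        rw [← SetLike.mem_coe, coe_mappingTorusPieceTwo]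
        norm_num
      refine ⟨jB (φ x, ⟨1, h1⟩), ?_⟩
      rw [hfB, hqB_def]
      simpa using MappingTorus.mk_apply_add_one φ x 0
    · have ht : t ∈ mappingTorusPieceOne := by
        rw [← SetLike.mem_coe, coe_mappingTorusPieceOne]
        exact ⟨ht0, ht1⟩
      exact ⟨jA (x, ⟨t, ht⟩), hfA _⟩
  refine ⟨((IsOpenEmbedding.of_continuous_injective_isOpenMap hcont hinj hopen).isEmbedding
    ).toHomeomorphOfSurjective hsurj, fun a ↦ ?_, fun b ↦ ?_⟩
  · exact hfA a
  · exact hfB b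

end Comparison

/-! ### Elementary lemmas: integer-valued continuous functions, `circlePt` on `[0, 1]` -/

section Elementary

/-- A continuous real function on a preconnected space with values in `ℤ a` is constant.
[folklore] -/
theorem eq_of_continuous_of_mem_zmultiples {X : Type*} [TopologicalSpace X] [PreconnectedSpace X]
    {f : X → ℝ} (hf : Continuous f) (a : ℝ) (h : ∀ x, f x ∈ AddSubgroup.zmultiples a) (x y : X) :
    f x = f y :=
  isPreconnected_univ.constant_of_mapsTo (T := (AddSubgroup.zmultiples a : Set ℝ))
    (isDiscrete_iff_discreteTopology.2
      (inferInstanceAs (DiscreteTopology (AddSubgroup.zmultiples a))))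
    hf.continuousOn (fun x _ ↦ h x) (mem_univ x) (mem_univ y)

/-- Two points of `[0, 1]` with the same image under `circlePt` are equal or are the two
endpoints. [folklore] -/
theorem eq_or_of_circlePt_eq {s t : ℝ} (hs : s ∈ Icc (0 : ℝ) 1) (ht : t ∈ Icc (0 : ℝ) 1)
    (h : circlePt s = circlePt t) : s = t ∨ (s = 0 ∧ t = 1) ∨ (s = 1 ∧ t = 0) := by
  obtain ⟨m, hm⟩ := circlePt_eq_circlePt_iff.1 h
  obtain ⟨hs0, hs1⟩ := hs
  obtain ⟨ht0, ht1⟩ := ht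
  have hm1 : (m : ℝ) ≤ 1 := by linarith
  have hm2 : (-1 : ℝ) ≤ m := by linarith
  have hm1' : m ≤ 1 := by exact_mod_cast hm1
  have hm2' : -1 ≤ m := by exact_mod_cast hm2
  interval_cases m
  · right; left
    push_cast at hm
    constructor <;> linarith
  · left
    push_cast at hm
    linarith
  · right; right
    push_cast at hm
    constructor <;> linarith

end Elementary

/-! ### The degree of the push-off of the section circle -/

section Degree

variable (A : Matrix.SpecialLinearGroup (Fin 3) ℤ) {T : Type*} [TopologicalSpace T]
  [ChartedSpace (EuclideanSpace ℝ (Fin 4)) T]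

/-- **The push-off of the section circle has degree `±1`.** Let `T` be identified with the model
mapping torus `T_A` by `Φ`, let `c : 𝕊¹ → T` be an injective circle mapped by `Φ` into the
section `{[(1, t)]}`, and `ν : 𝕊¹ × ℝ³ ↪ T` a tube with core `c`. If `Λ : [0, 1] → ℝ³ × ℝ` is a
continuous lift, through the universal covering `P = Φ⁻¹ ∘ cover A : ℝ³ × ℝ → T`, of the push-off
loop `t ↦ ν (circlePt t, w)`, then the `ℝ`-coordinate of `Λ` changes by exactly `±1` from `t = 0`
to `t = 1`. Proof: lift the homotopy `(t, s) ↦ ν (circlePt t, (1 - s) w)` from the push-off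
(`s = 0`) to the core circle (`s = 1`); the change of the `ℝ`-coordinate along `t` is an integer
(the two ends lie over the same point) depending continuously on `s`, hence constant; at `s = 1`
the lift of `t ↦ c (circlePt t)` stays in `2πℤ³ × ℝ`, so it is `t ↦ (x₁, τ t)` with
`c (circlePt t) = Φ⁻¹ [(1, τ t)]`; injectivity of `c` makes `τ` injective on `[0, 1)` modulo `1`,
and the intermediate value theorem forces `τ 1 - τ 0 = ±1`. [folklore] -/
theorem snd_sub_snd_of_lift_pushOff (Φ : T ≃ₜ MappingTorus (monodromyHomeo A))
    {c : Metric.sphere (0 : EuclideanSpace ℝ (Fin 2)) 1 → T} (hc : Injective c)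
    (hcΦ : ∀ u, Φ (c u) ∈ modelSection A) (ν : CircleNbhd (𝓡 4) c) (w : EuclideanSpace ℝ (Fin 3))
    {Λ : I → EuclideanSpace ℝ (Fin 3) × ℝ} (hΛ : Continuous Λ)
    (hΛlift : ∀ t, Φ.symm (cover A (Λ t)) = ν.toFun (circlePt t, w)) :
    (Λ 1).2 - (Λ 0).2 = 1 ∨ (Λ 1).2 - (Λ 0).2 = -1 := by
  -- the covering `P = Φ⁻¹ ∘ cover A : ℝ⁴ → T`
  set P : EuclideanSpace ℝ (Fin 3) × ℝ → T := Φ.symm ∘ cover A with hP_def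
  have hP : IsQuotientCoveringMap P (Deck A) :=
    (isQuotientCoveringMap_cover A).homeomorph_comp Φ.symm
  have cov := hP.isCoveringMap
  -- the homotopy `H (t, s) = ν (circlePt t, (1 - s) • w)` from the push-off to the core circle
  let H : C(I × I, T) := ⟨fun q ↦ ν.toFun (circlePt q.1, (1 - (q.2 : ℝ)) • w),
    ν.continuous.comp
      ((continuous_circlePt.comp (continuous_subtype_val.comp continuous_fst)).prodMk
      ((continuous_const.sub (continuous_subtype_val.comp continuous_snd)).smul continuous_const))⟩
  have hH : ∀ t s : I, H (t, s) = ν.toFun (circlePt t, (1 - (s : ℝ)) • w) := fun _ _ ↦ rfl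
  -- the base path `s ↦ H (0, s)` and its lift from `Λ 0`
  let β : C(I, T) := H.comp ⟨fun s ↦ ((0 : I), s), by fun_prop⟩
  have hβ0 : β 0 = P (Λ 0) := by
    change H (0, 0) = Φ.symm (cover A (Λ 0))
    rw [hH, hΛlift 0]
    simp
  let f : C(I, EuclideanSpace ℝ (Fin 3) × ℝ) := cov.liftPath β (Λ 0) hβ0
  have hH0 : ∀ s, H (0, s) = P (f s) := fun s ↦ (congrFun (cov.liftPath_lifts β (Λ 0) hβ0) s).symm
  -- the lifted homotopy
  let G : C(I × I, EuclideanSpace ℝ (Fin 3) × ℝ) := cov.liftHomotopy H f hH0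
  have hG : ∀ t s, P (G (t, s)) = H (t, s) := fun t s ↦
    congrFun (cov.liftHomotopy_lifts H f hH0) (t, s)
  have hG0 : ∀ s, G (0, s) = f s := cov.liftHomotopy_zero H f hH0
  -- (a) at `s = 0` the lifted homotopy is the given lift `Λ` (uniqueness of lifts)
  have hℓ0 : (⟨fun t ↦ ν.toFun (circlePt t, w), ν.continuous.comp
      ((continuous_circlePt.comp continuous_subtype_val).prodMk continuous_const)⟩ : C(I, T)) 0 =
      P (Λ 0) := (hΛlift 0).symm
  have hGΛ : ∀ t, G (t, 0) = Λ t := by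
    have h1 : (fun t ↦ G (t, 0)) = cov.liftPath _ (Λ 0) hℓ0 := by
      rw [cov.eq_liftPath_iff]
      refine ⟨by fun_prop, funext fun t ↦ ?_, ?_⟩
      · change P (G (t, 0)) = ν.toFun (circlePt t, w)
        rw [hG, hH]
        simp
      · rw [hG0]
        exact cov.liftPath_zero β (Λ 0) hβ0
    have h2 : Λ = cov.liftPath _ (Λ 0) hℓ0 := by
      rw [cov.eq_liftPath_iff]
      exact ⟨hΛ, funext fun t ↦ hΛlift t, rfl⟩
    intro t
    have := congrFun (h1.trans h2.symm) t
    exact this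
  -- (b) the degree `Δ s = (G (1, s)).2 - (G (0, s)).2` is an integer, continuous in `s`: constant
  have hΔint : ∀ s, ∃ k : ℤ, (G (1, s)).2 - (G (0, s)).2 = k := by
    intro s
    have h10 : circlePt ((1 : I) : ℝ) = circlePt ((0 : I) : ℝ) := by
      rw [Set.Icc.coe_one, Set.Icc.coe_zero, ← circlePt_add_one 0, zero_add]
    have h1 : P (G (1, s)) = P (G (0, s)) := by
      rw [hG, hG, hH, hH, h10]
    rw [hP.apply_eq_iff_mem_orbit, MulAction.mem_orbit_iff] at h1
    obtain ⟨g, hg⟩ := h1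
    exact ⟨g.right.toAdd, by rw [← hg, Deck.smul_snd]; ring⟩
  have hΔconst : (G (1, 0)).2 - (G (0, 0)).2 = (G (1, 1)).2 - (G (0, 1)).2 :=
    eq_of_continuous_of_mem_zmultiples (f := fun s ↦ (G (1, s)).2 - (G (0, s)).2) (by fun_prop) 1
      (fun s ↦ by
        obtain ⟨k, hk⟩ := hΔint s
        rw [hk, AddSubgroup.mem_zmultiples_iff]
        exact ⟨k, by simp⟩) 0 1
  -- (c) at `s = 1`: the lift `κ t = G (t, 1)` of the core circle `t ↦ c (circlePt t)`
  set κ : I → EuclideanSpace ℝ (Fin 3) × ℝ := fun t ↦ G (t, 1) with hκ_def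
  have hκc : Continuous κ := G.continuous.comp (continuous_id.prodMk continuous_const)
  have hκ : ∀ t, P (κ t) = c (circlePt t) := fun t ↦ by
    rw [hκ_def]
    dsimp only
    rw [hG, hH]
    simp [ν.apply_zero]
  have hκ1 : ∀ t, expT (κ t).1 = 1 := by
    intro t
    rw [← cover_mem_modelSection_iff]
    have : cover A (κ t) = Φ (P (κ t)) := (Φ.apply_symm_apply _).symm
    rw [this, hκ t]
    exact hcΦ _
  -- the `ℝ³`-coordinate lies in the lattice, hence is constant
  have hκfst : ∀ t, (κ t).1 = (κ 0).1 := by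
    intro t
    ext j
    refine eq_of_continuous_of_mem_zmultiples (f := fun t ↦ (κ t).1 j) (by fun_prop) (2 * π)
      (fun t' ↦ ?_) t 0
    obtain ⟨n, hn⟩ := (expT_eq_one_iff _).1 (hκ1 t')
    change (κ t').1 j ∈ _
    rw [hn, latVec_apply, AddSubgroup.mem_zmultiples_iff]
    exact ⟨n j, by rw [zsmul_eq_mul, mul_comm]⟩
  -- hence `c (circlePt t) = Φ⁻¹ [(1, τ t)]` with `τ t = (κ t).2`
  set τ : I → ℝ := fun t ↦ (κ t).2 with hτ_def
  have hτc : Continuous τ := continuous_snd.comp hκc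
  have hcτ : ∀ t : I, c (circlePt (t : ℝ)) =
      Φ.symm (MappingTorus.mk (monodromyHomeo A) 1 (τ t)) := by
    intro t
    rw [← hκ t]
    change Φ.symm (MappingTorus.mk _ (expT (κ t).1) (κ t).2) = _
    rw [hκ1 t]
  -- (d) injectivity of `c`: `τ t = τ t' (+1)` forces `circlePt t = circlePt t'`
  have hinj : ∀ t t' : I, τ t = τ t' → circlePt (t : ℝ) = circlePt t' := fun t t' h ↦
    hc (by rw [hcτ, hcτ, h])
  have hmk1 : ∀ r : ℝ, MappingTorus.mk (monodromyHomeo A) 1 (r + 1) =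
      MappingTorus.mk (monodromyHomeo A) 1 r := fun r ↦ by
    conv_lhs => rw [show (1 : ThreeTorus) = monodromyHomeo A 1 from
      (torusDiffeomorph_apply_one A).symm]
    exact MappingTorus.mk_apply_add_one _ 1 r
  have hinj1 : ∀ t t' : I, τ t = τ t' + 1 → circlePt (t : ℝ) = circlePt t' := fun t t' h ↦
    hc (by rw [hcτ, hcτ, h, hmk1])
  -- (e) the degree at `s = 1` is `d = τ 1 - τ 0 ∈ ℤ`; we show `d = ±1`
  have hτG : (G (1, 1)).2 - (G (0, 1)).2 = τ 1 - τ 0 := rfl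
  obtain ⟨k, hk⟩ := hΔint 1
  -- the extension of `τ` to `ℝ` for the intermediate value theorem
  set τ' : ℝ → ℝ := IccExtend zero_le_one τ with hτ'_def
  have hτ'c : Continuous τ' := hτc.Icc_extend'
  have hτ'eq : ∀ t : I, τ' t = τ t := fun t ↦ by
    rw [hτ'_def, IccExtend_of_mem _ _ t.2]
  have hτ'0 : τ' 0 = τ 0 := by rw [← hτ'eq 0, Set.Icc.coe_zero]
  have hτ'1 : τ' 1 = τ 1 := by rw [← hτ'eq 1, Set.Icc.coe_one]
  have hIcc : ∀ x : ℝ, x ∈ Icc (0 : ℝ) 1 → ∃ t : I, (t : ℝ) = x := fun x hx ↦ ⟨⟨x, hx⟩, rfl⟩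
  -- `τ' x = τ 0 + 1` or `τ 0 = τ' x + 1` only at the endpoints
  have hends : ∀ x : ℝ, x ∈ Icc (0 : ℝ) 1 → (τ' x = τ 0 + 1 ∨ τ 0 = τ' x + 1) → x = 0 ∨ x = 1 := by
    intro x hx h
    obtain ⟨t, rfl⟩ := hIcc x hx
    rw [hτ'eq] at h
    have hct : circlePt (t : ℝ) = circlePt ((0 : I) : ℝ) := by
      rcases h with h | h
      · exact hinj1 t 0 h
      · exact (hinj1 0 t h).symm
    rcases eq_or_of_circlePt_eq t.2 (0 : I).2 hct with h' | ⟨h', -⟩ | ⟨h', -⟩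
    · left; exact_mod_cast h'
    · left; exact h'
    · right; exact h'
  have hk1 : ¬ (2 : ℤ) ≤ k := by
    intro hk2
    -- `τ 0 + 1 ∈ [τ 0, τ 1]` is a value `τ' x`, `x ∈ [0, 1]`
    have hk' : τ 1 - τ 0 = k := hτG.symm.trans hk
    have h2 : (2 : ℝ) ≤ k := by exact_mod_cast hk2
    have hv : τ 0 + 1 ∈ Icc (τ' 0) (τ' 1) := by
      rw [hτ'0, hτ'1]
      constructor <;> linarith
    obtain ⟨x, hx, hxv⟩ := intermediate_value_Icc zero_le_one hτ'c.continuousOn hv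
    rcases hends x hx (Or.inl hxv) with rfl | rfl
    · rw [hτ'0] at hxv
      linarith
    · rw [hτ'1] at hxv
      linarith
  have hk2 : ¬ k ≤ -2 := by
    intro hk2
    have hk' : τ 1 - τ 0 = k := hτG.symm.trans hk
    have h2 : (k : ℝ) ≤ -2 := by exact_mod_cast hk2
    have hv : τ 0 - 1 ∈ Icc (τ' 1) (τ' 0) := by
      rw [hτ'0, hτ'1]
      constructor <;> linarith
    obtain ⟨x, hx, hxv⟩ := intermediate_value_Icc' zero_le_one hτ'c.continuousOn hv
    rcases hends x hx (Or.inr (by rw [hxv]; ring)) with rfl | rfl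
    · rw [hτ'0] at hxv
      linarith
    · rw [hτ'1] at hxv
      linarith
  have hk0 : k ≠ 0 := by
    intro hk0
    rw [hk0, Int.cast_zero, hτG, sub_eq_zero] at hk
    -- `τ 1 = τ 0`; compare with the value at `1/2`
    let th : I := ⟨1 / 2, by norm_num, by norm_num⟩
    have hth : τ th ≠ τ 0 := by
      intro h
      rcases eq_or_of_circlePt_eq th.2 (0 : I).2 (hinj th 0 h) with h' | ⟨h', -⟩ | ⟨h', -⟩ <;>
        norm_num [th] at h'
    -- the value `v` halfway between `τ 0` and `τ (1/2)` is taken on `[0, 1/2]` and on `[1/2, 1]`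
    set v : ℝ := (τ 0 + τ th) / 2 with hv_def
    have hv0 : v ≠ τ 0 := by
      intro h; apply hth; rw [hv_def] at h; linarith
    have hvh : v ≠ τ th := by
      intro h; apply hth; rw [hv_def] at h; linarith
    have hτ'h : τ' (1 / 2) = τ th := hτ'eq th
    have hτ'1' : τ' 1 = τ 0 := by rw [hτ'1, hk]
    have hx1 : ∃ x ∈ Icc (0 : ℝ) (1 / 2), τ' x = v := by
      rcases lt_or_gt_of_ne hth with hlt | hgt
      · have hv : v ∈ Icc (τ' (1 / 2)) (τ' 0) := by
          rw [hτ'0, hτ'h, hv_def]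
          constructor <;> linarith
        exact intermediate_value_Icc' (by norm_num) hτ'c.continuousOn hv
      · have hv : v ∈ Icc (τ' 0) (τ' (1 / 2)) := by
          rw [hτ'0, hτ'h, hv_def]
          constructor <;> linarith
        exact intermediate_value_Icc (by norm_num) hτ'c.continuousOn hv
    have hx2 : ∃ x ∈ Icc (1 / 2 : ℝ) 1, τ' x = v := by
      rcases lt_or_gt_of_ne hth with hlt | hgt
      · have hv : v ∈ Icc (τ' (1 / 2)) (τ' 1) := by
          rw [hτ'1', hτ'h, hv_def]
          constructor <;> linarith
        exact intermediate_value_Icc (by norm_num) hτ'c.continuousOn hv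
      · have hv : v ∈ Icc (τ' 1) (τ' (1 / 2)) := by
          rw [hτ'1', hτ'h, hv_def]
          constructor <;> linarith
        exact intermediate_value_Icc' (by norm_num) hτ'c.continuousOn hv
    obtain ⟨x₁, ⟨hx₁0, hx₁1⟩, hx₁v⟩ := hx1
    obtain ⟨x₂, ⟨hx₂0, hx₂1⟩, hx₂v⟩ := hx2
    have hx₁I : x₁ ∈ Icc (0 : ℝ) 1 := ⟨hx₁0, by linarith⟩
    have hx₂I : x₂ ∈ Icc (0 : ℝ) 1 := ⟨by linarith, hx₂1⟩
    obtain ⟨t₁, rfl⟩ := hIcc x₁ hx₁I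
    obtain ⟨t₂, rfl⟩ := hIcc x₂ hx₂I
    rw [hτ'eq] at hx₁v hx₂v
    -- `x₁ ≠ 1/2 ≠ x₂`, so `x₁ < x₂`, and `(x₁, x₂) ≠ (0, 1)` since `τ 0 ≠ v`
    have hne1 : (t₁ : ℝ) ≠ 1 / 2 := by
      intro h
      have : t₁ = th := Subtype.ext h
      rw [this] at hx₁v
      exact hvh hx₁v.symm
    have hne2 : (t₂ : ℝ) ≠ 1 / 2 := by
      intro h
      have : t₂ = th := Subtype.ext h
      rw [this] at hx₂v
      exact hvh hx₂v.symm
    have hct : circlePt (t₁ : ℝ) = circlePt t₂ := hinj t₁ t₂ (hx₁v.trans hx₂v.symm)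
    rcases eq_or_of_circlePt_eq t₁.2 t₂.2 hct with h' | ⟨h', -⟩ | ⟨-, h'⟩
    · have : (t₁ : ℝ) < t₂ := lt_of_lt_of_le (lt_of_le_of_ne hx₁1 hne1)
        (le_of_lt (lt_of_le_of_ne hx₂0 (Ne.symm hne2)))
      exact absurd h' (ne_of_lt this)
    · have : t₁ = 0 := Subtype.ext h'
      rw [this] at hx₁v
      exact hv0 hx₁v.symm
    · have : t₂ = 0 := Subtype.ext h'
      rw [this] at hx₂v
      exact hv0 hx₂v.symm
  -- conclusion
  have hkpm : k = 1 ∨ k = -1 := by omega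
  rw [← hGΛ 1, ← hGΛ 0, hΔconst, hk]
  rcases hkpm with rfl | rfl
  · left; simp
  · right; simp

end Degree

/-! ### Discharge of the named fact and of the target -/

section Discharge

/-- **Discharge of `normalClosure_pushOff_eq_top`**: the fundamental group of the complement
`T ∖ c(𝕊¹)` of the section circle of a Cappell–Shaneson mapping torus is the normal closure of the
push-off of `c`. Proof (Cappell–Shaneson, Ann. of Math. 104 (1976), §2, "homotopy 4-sphere";
details as in Hatcher, *Algebraic Topology*, Prop. 1.40): identify `T` with the model mapping
torus (`exists_homeomorph_mappingTorus_of_isOpenEmbedding`), so that `T ∖ c` is the base of the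
quotient covering `(ℝ³ ∖ 2πℤ³) × ℝ → T_A ∖ section` by the free action of `Γ = ℤ³ ⋊_A ℤ`
(`isQuotientCoveringMap_coverRestrict`) with simply connected total space
(`simplyConnectedSpace_coverSub`); Mathlib's `IsQuotientCoveringMap.fundamentalGroupToMulOpposite`
is then a group isomorphism `π₁(T ∖ c) ≅ Γᵒᵖ` sending the push-off to `op g` where `g` moves the
base point of the universal cover to the end of the lifted push-off; by
`snd_sub_snd_of_lift_pushOff` the degree of `g` is `±1`, so `Deck.normalClosure_eq_top`
(which uses `det (A - 1) = ±1`) shows that `g⁻¹`, hence `op g`, normally generates, and normal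
generation is transported back along the isomorphism. [cite: CappellShanesonAnnals1976, §2] -/
theorem normalClosure_pushOff_eq_top_holds : normalClosure_pushOff_eq_top := by
  intro A hA T _ _ _ _ _ _ jA jB hT c hc hcr ν w hw
  have hT' := hT
  obtain ⟨hAe, hAo, hBe, hBo, hcov, hR⟩ := hT'
  -- Step 1: the comparison homeomorphism with the model mapping torus
  obtain ⟨Φ, hΦA, hΦB⟩ := exists_homeomorph_mappingTorus_of_isOpenEmbedding (monodromyHomeo A)
    ⟨hAe.isEmbedding, hAo⟩ ⟨hBe.isEmbedding, hBo⟩ hcov (fun a b ↦ by rw [hR]; rfl)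
  -- `Φ` maps the section circle onto the model section
  have hmk : ∀ (z : ThreeTorus) (s : ℝ),
      MappingTorus.mk (monodromyHomeo A) z s ∈ modelSection A ↔ z = 1 := by
    intro z s
    constructor
    · rintro ⟨t, ht⟩
      rw [MappingTorus.mk_eq_mk_iff] at ht
      obtain ⟨k, -, h⟩ := ht
      rw [monodromy_zpow_one] at h
      exact h
    · rintro rfl
      exact ⟨s, rfl⟩
  have hsec : ∀ x : T, Φ x ∈ modelSection A ↔ x ∈ range c := by
    intro x
    rw [hcr]
    have hx : x ∈ range jA ∪ range jB := by rw [hcov]; exact mem_univ x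
    rcases hx with ⟨⟨z, s⟩, rfl⟩ | ⟨⟨z, t⟩, rfl⟩
    · rw [jA_mem_section_iff hT z s, hΦA, hmk]
    · rw [jB_mem_section_iff hT z t, hΦB, hmk]
  have hcΦ : ∀ u, Φ (c u) ∈ modelSection A := fun u ↦ (hsec _).2 ⟨u, rfl⟩
  -- Step 2: the covering `F : E → T ∖ c` of the complement, transported from the model
  let Ψ : ↥(modelSection A)ᶜ ≃ₜ ↥ν.complement :=
    Φ.symm.subtype (p := fun z ↦ z ∈ (modelSection A)ᶜ) (q := fun x ↦ x ∈ ν.complement)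
      (fun z ↦ by
        rw [CircleNbhd.mem_complement_iff, ← hsec, Φ.apply_symm_apply, mem_compl_iff])
  set F : ↥(coverSub A) → ↥ν.complement := Ψ ∘ coverRestrict A with hF_def
  have hF : IsQuotientCoveringMap F (Deck A) :=
    (isQuotientCoveringMap_coverRestrict A).homeomorph_comp Ψ
  have hFval : ∀ y : ↥(coverSub A), ((F y : ↥ν.complement) : T) = Φ.symm (cover A y) :=
    fun y ↦ rfl
  -- base points
  obtain ⟨e₀, he₀⟩ := hF.surjective (ν.tubePt ptA hw)
  let e : F ⁻¹' {ν.tubePt ptA hw} := ⟨e₀, he₀⟩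
  -- Step 3: `π₁(T ∖ c, a₀) ≅ Γᵒᵖ` (Hatcher 1.40, Mathlib; the cover is simply connected)
  haveI := simplyConnectedSpace_coverSub A
  let ρ := hF.fundamentalGroupToMulOpposite e
  have hρinj : Injective ρ := hF.fundamentalGroupToMulOpposite_injective e
  have hρsurj : Surjective ρ := hF.fundamentalGroupToMulOpposite_surjective e
  set γ : FundamentalGroup (↥ν.complement) (ν.tubePt ptA hw) :=
    FundamentalGroup.fromPath (Path.Homotopic.Quotient.mk (ν.pushOff hw)) with hγ_def
  set g : Deck A := (ρ γ).unop with hg_def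
  have hργ : ρ γ = MulOpposite.op g := (MulOpposite.op_unop _).symm
  -- the monodromy of `γ`: `g • e₀` is the end of the lift `Λ` of the push-off starting at `e₀`
  have hmono : g • (e₀ : ↥(coverSub A)) = (hF.isCoveringMap.monodromy γ e : ↥(coverSub A)) :=
    hF.unop_fundamentalGroupToMulOpposite_smul
  have hℓ0 : (ν.pushOff hw).toContinuousMap 0 = F e₀ := by
    rw [he₀]
    exact (ν.pushOff hw).source
  set Λ : C(I, ↥(coverSub A)) := hF.isCoveringMap.liftPath (ν.pushOff hw).toContinuousMap e₀ hℓ0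
    with hΛ_def
  have hmonoΛ : (hF.isCoveringMap.monodromy γ e : ↥(coverSub A)) = Λ 1 := rfl
  have hΛ0 : Λ 0 = e₀ := hF.isCoveringMap.liftPath_zero _ _ hℓ0
  have hΛlift : ∀ t, F (Λ t) = ν.pushOff hw t := fun t ↦
    congrFun (hF.isCoveringMap.liftPath_lifts _ _ hℓ0) t
  -- Step 4: the degree of `g` is `±1`
  have hdeg := snd_sub_snd_of_lift_pushOff A Φ hc.isEmbedding.injective hcΦ ν w
    (Λ := fun t ↦ ((Λ t : ↥(coverSub A)) : EuclideanSpace ℝ (Fin 3) × ℝ)) (by fun_prop) (fun t ↦ by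
      change ((F (Λ t) : ↥ν.complement) : T) = _
      rw [hΛlift t, CircleNbhd.pushOff_apply, CircleNbhd.coe_tubePt])
  have hk : ((g.right.toAdd : ℤ) : ℝ) =
      ((Λ 1 : ↥(coverSub A)) : EuclideanSpace ℝ (Fin 3) × ℝ).2 -
        ((Λ 0 : ↥(coverSub A)) : EuclideanSpace ℝ (Fin 3) × ℝ).2 := by
    rw [hΛ0, ← hmonoΛ, ← hmono, SubMulAction.val_smul, Deck.smul_snd]
    ring
  have hg : g.right = Multiplicative.ofAdd 1 ∨ g.right = Multiplicative.ofAdd (-1) := by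
    rcases hdeg with h | h
    · left
      apply Multiplicative.toAdd.injective
      rw [toAdd_ofAdd]
      exact_mod_cast hk.trans h
    · right
      apply Multiplicative.toAdd.injective
      rw [toAdd_ofAdd]
      exact_mod_cast hk.trans h
  -- Step 5: the algebra in `Γ = ℤ³ ⋊_A ℤ` (uses `det (A - 1) = ±1`), transported to `Γᵒᵖ`
  have hginv : (g⁻¹).right = Multiplicative.ofAdd 1 ∨ (g⁻¹).right = Multiplicative.ofAdd (-1) := by
    rw [SemidirectProduct.inv_right]
    rcases hg with h | h
    · right; rw [h, ofAdd_neg]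
    · left; rw [h, ofAdd_neg, inv_inv]
  have halg : Subgroup.normalClosure {g⁻¹} = (⊤ : Subgroup (Deck A)) :=
    Deck.normalClosure_eq_top A hA g⁻¹ hginv
  have hop : Subgroup.normalClosure {MulOpposite.op g} = (⊤ : Subgroup (Deck A)ᵐᵒᵖ) := by
    have h1 := Subgroup.map_normalClosure {g⁻¹} (MulEquiv.inv' (Deck A)).toMonoidHom
      (MulEquiv.inv' (Deck A)).surjective
    rw [halg, Subgroup.map_top_of_surjective _ (MulEquiv.inv' (Deck A)).surjective,
      image_singleton] at h1
    rw [h1]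
    congr 2
    simp
  -- Step 6: conclusion, back along `ρ`
  have hmap := Subgroup.map_normalClosure ({γ} : Set _) ρ hρsurj
  rw [image_singleton, hργ, hop] at hmap
  rw [← Subgroup.comap_map_eq_self_of_injective hρinj (Subgroup.normalClosure {γ}), hmap,
    Subgroup.comap_top]

end Discharge

end CappellShaneson

/-! ### The target -/

section Target

universe u

/-- **Cappell–Shaneson spheres are simply connected** — discharge of the named fact
`Literature.Topology.FourManifolds.simplyConnectedSpace_of_isCappellShanesonSphere` of
`Literature.Topology.FourManifolds.CappellShaneson`: every 4-manifold obtained from the mapping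
torus of `A ∈ SL(3, ℤ)`, `det (A - 1) = ±1`, acting on `T³`, by surgery on the section circle
(either framing) is simply connected. The printed sources state this without proof
(Cappell–Shaneson, *Some new four-manifolds*, Ann. of Math. 104 (1976), §2: the surgered
manifold is a homotopy sphere when `det (A - 1) = ±1`; Gompf, Algebr. Geom. Topol. 10 (2010),
§2: "`X^ε_φ` is a homotopy 4-sphere if and only if `det (A - I) = ±1`"; Gompf, Topology Appl. 38
(1991), p. 124: "easy to verify"). The proof recorded here is van Kampen's easy half
(`CappellShaneson.simplyConnectedSpace_of_isCappellShanesonSphere_of`) plus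
`π₁(T ∖ c) = ⟨⟨push-off⟩⟩` (`CappellShaneson.normalClosure_pushOff_eq_top_holds`: universal
cover `(ℝ³ ∖ 2πℤ³) × ℝ`, deck group `ℤ³ ⋊_A ℤ`, Hatcher Prop. 1.40, and the unimodularity of
`A - 1`). The binders are those of the constant (a charted space `X`).
[cite: CappellShanesonAnnals1976, §2] -/
theorem simplyConnectedSpace_of_isCappellShanesonSphere_holds (X : Type u) [TopologicalSpace X]
    [ChartedSpace (EuclideanSpace ℝ (Fin 4)) X] :
    FourManifolds.simplyConnectedSpace_of_isCappellShanesonSphere X :=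
  CappellShaneson.simplyConnectedSpace_of_isCappellShanesonSphere_of
    CappellShaneson.normalClosure_pushOff_eq_top_holds X

end Target

end Literature.Topology.FourManifolds
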